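import Literature.MathematicalPhysics.QuantumFieldTheory.Balaban1983to89.B9Eq3126H1Bound
import Literature.MathematicalPhysics.QuantumFieldTheory.Balaban1983to89.B9Eq386ResolventLetters
import Literature.MathematicalPhysics.QuantumFieldTheory.Balaban1983to89.B9Eq384LaplaceALipschitz

/-!
# `Balaban1983to89.B9Eq386LipschitzH1` — T. Bałaban, *Propagators for lattice gauge theories in a background field*, Commun. Math. Phys. **99** (1985)
# 389–434 [Balaban1985BackgroundPropagators] Thm 3.4 p. 400 / (3.86) p. 407 with (3.126) p. 420 and Thm 3.11 p. 416: AT A FIXED LATTICE THE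
# pub-balaban NE9 CHAIN'S `G₁(U) = Δ_a(U)⁻¹` AND `H₁(U) = G₁Q†(QG₁Q†)⁻¹` ARE LIPSCHITZ IN THE BACKGROUND AT THE FLAT POINT —
# `‖G₁(U) − G₁(1)‖ ≤ C₁·ε`, `‖H₁(U) − H₁(1)‖ ≤ C₂·ε` for `‖U(b) − 1‖ ≤ ε ≤ ε₇` (L² operator norms; `‖Δ_a(U) − Δ_a(1)‖ ≤ C_Δ·ε` by `B9Eq384LaplaceALipschitz`): print's «small
# perturbations of the operators depending on U only», made quantitative for the chain's letters by the resolvent algebra of `B9Eq386ResolventLetters`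

statement-level skeleton of published theorems with citation tags; proofs where landed; nothing here is a claim about the Yang–Mills mass gap

PDF held: `paper:balaban1985-cmp99-background-propagators` (journal page = PDF page + 388), pp. 400, 404–407, 416, 420 read by this seat (2026-08-22).

THE PRINT (first-hand, text layer).  p. 400, Thm 3.4: *«There exists a positive constant a₁ such that the operators G′(U), (Q′(U)G′²(U)Q′*(U))⁻¹, R(U), G(U)
extend to configurations U′U for α₁ ≤ a₁ as analytic functions of A. The extended operators satisfy all the inequalities of Theorems 3.1-3.3
correspondingly. In fact we prove quantitative statements which are more precise, describing these analytic extensions as small perturbations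
of the operators depending on U only»*; p. 407: *«We can write (3.82) as Δ_a(U′U) = Δ_a(U) − V(A) =
(I − V(A)G(U))Δ_a(U). (3.84) … hence V(A)G(U) is a small operator in supremum norm, and we have G(U′U) = G(U)(I − V(A)G(U))⁻¹ = Σ_{n=0}^∞
G(U)(V(A)G(U))ⁿ, (3.86) and convergence is in the operator norm for α₁ sufficiently small»*; p. 420, (3.126): *«HB = GQ*(QGQ*)⁻¹B»*.
(DOCFIX, gen 81, docstring-only — statements and proofs byte-identical: the v1 header's «verbatim» quotations were
paraphrases (reader ne9-leaf-02 g57 R-ne9leaf02-g57-1); replaced by the text layer's words, read first-hand.)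

WHY THIS FILE (cell context).  Generations 79–81 of the pub-balaban NE9 owner lineage made the chain's `Δ_a(U)` positive (`B9Thm311SmallFieldClosed`),
`G₁(U)`, `H₁(U)`, `𝔊(U)` bounded UNIFORMLY over the small fields (`B9Thm311SmallFieldGreen`, `B9Eq3126H1Bound`, `B9Eq3126H1BoundCLM`) and the chart of
the curve species `cur U` exist on ONE ball for all of them (`Support/NE9CurChartOfBackground` v1.4).  A FAMILY in the background needs next the
CONTINUITY of the letters in `U`; this file proves the first-order statement at the flat point for `G₁` and `H₁`: the linear remainder
`‖Δ_a(U) − Δ_a(1)‖ ≤ C_Δ·ε` of `B9Eq384LaplaceALipschitz` ((3.84)) and NE9 leaf-04's `δ_Q` are transported by the resolvent step (3.86)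
(`B9Eq386ResolventLetters`) to `G₁` and to `H₁` of (3.126), with the uniform coercivity / operator bound / modulus letters of gens 80–81.

WHAT IS PROVED (sorry-free; no `Prop` placeholder; no inequality of the paper asserted).
* **`exists_lipschitz_G1_H1_at_flat`** — `∃ C₁ C₂ ε₇ > 0 ∀ U` (E162 data, `‖U(b) − 1‖ ≤ ε ≤ ε₇`, `hRS`) `∀ hpos hQ` (at `U`) `∀ hpos₁ hQ₁` (at `1`):
  `‖G₁(U)z − G₁(1)z‖ ≤ C₁·ε·‖z‖` and `‖H₁(U)b − H₁(1)b‖ ≤ C₂·ε·‖b‖` — (3.86) and (3.126) at a fixed lattice, first order at the flat point.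
MODEL / HONEST SCOPE.  [folklore] finite-dimensional perturbation theory at a FIXED lattice; `C₁, C₂, ε₇` depend on `L, m, η, c₀, c₁, a`,
`M_φ, M_φ′, C_τ`; Lipschitz AT THE FLAT POINT only (the remainders of `B9Eq373DerivativeRemainderL2` are relative to the flat transporters) — NOT
between two general small fields, NOT analyticity in `A`, NOT print's uniformity in the lattice, NOT `𝔊(U)` (needs the `R(U)`-letter's Lipschitz
bound in isolation; next); NOT summit progress (cell pub-balaban: NE9 NOT PRINTED / NOT PROVED; spine PROVED 0/9; rung (B)+1 finite T⁴ — NOT infinite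
volume, NOT mass gap, NOT BetaPertH, NOT Clay).  HONEST DEPENDENCY (cell line): continuum YM on T⁴ ⇐ BetaPertH ∧ nine spine estimates (0/9 proved);
BetaPertH ⇐ (D1) ∧ (D4) ∧ CAP+tail; G-an2-4 gates asym, D1 and NE2/3/4.  Filed by the pub-balaban NE9 BINDER-row owner lineage `b2b-balaban-t4-ne9-p1`
(gen 81); NEW file importing `B9Eq3126H1Bound`, `B9Eq386ResolventLetters`, `B9Eq384LaplaceALipschitz` only; nothing modified.  Net new unproved facts: 0.
-/

noncomputable section

open scoped InnerProductSpace ComplexConjugate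

namespace Literature.MathematicalPhysics.QuantumFieldTheory.Balaban1983to89.B9Eq386LipschitzH1

open B4Sect5Torus (TSite)
open B9SectCLatticeCarrier (Bond)
open B7Prop1Explicit (U1 Wcx boxVec)
open B9Eq311L2Pairing (WL2)
open B9Eq319QprimeTorus (fineP centre weight)
open B9Eq319Onto (centreFun)
open B11Eq103H1Complex (SiteL2K BondL2K covDerivL2K covDivL2K covLaplaceSiteK laplaceAK laplaceAK_apply laplaceALatticeK H1LatticeK G1LatticeK
  adjoint_injective_of_surjective)
open B9Eq310HessianOperator (adTransportW principalOpK hessOp hessOp_apply curvOp curvOp_one)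
open B9Eq310DeltaPrime (plaqHolU)
open B9Eq326OperatorAssembly (RofU QprimeW)
open B9Eq315QTorus (perCfg cornerSite QtorusW laplaceAofBackground)
open B9Eq315QTorusOnto (liftSite perSite_liftSite QtorusW_surjective)
open B5Eq172FlatCoercivity (hU1_one hreg_one)
open B9Eq373DerivativeRemainderL2 (norm_adjoint_apply_le)
open B9Eq384RemainderLetters (norm_centre_le norm_adTransportW_sub_le hRS_one)
open B9Eq323FlatBlockPoincare (exists_flat_modulus_explicit)
open B9Eq315QLipschitz (norm_QtorusW_sub_flat_le)
open B9Thm311SmallFieldGreen (exists_coercive_laplaceA_of_small_field)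
open B9Eq3126GreenLetters (exists_modulus_of_injective adjoint_injective_of_modulus)
open B9Eq3126H1Bound (norm_laplaceAofBackground_le)
open B9Eq386ResolventLetters (norm_G1K_sub_le norm_H1K_sub_le)
open B9Eq384LaplaceALipschitz (exists_laplaceAofBackground_sub_flat_le)

variable {d : ℕ} (L : ℕ) [NeZero L] (m : Fin d → ℕ) [∀ i, NeZero (fineP L m i)] (hL : 1 ≤ L)
  {𝔸 : Type*} [NormedRing 𝔸] [NormedAlgebra ℂ 𝔸] [CompleteSpace 𝔸] [NormOneClass 𝔸]
  {W : Type*} [NormedAddCommGroup W] [InnerProductSpace ℂ W] [FiniteDimensional ℂ W] (φ : W ≃ₗ[ℂ] 𝔸) {c₀ c₁ : ℝ} [Fact (0 < c₀)] [Fact (0 < c₁)]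


section Assembled

variable [StarRing 𝔸] [NormedStarGroup 𝔸] [StarModule ℂ 𝔸]

/-! ## §3 (3.86) and (3.126): `G₁(U)`, `H₁(U)` are Lipschitz in `U` at the flat point -/

set_option maxHeartbeats 800000 in
/-- **THM 3.4 / (3.86) / (3.126) AT A FIXED LATTICE, FIRST ORDER AT THE FLAT POINT: `‖G₁(U) − G₁(1)‖ ≤ C₁·ε`, `‖H₁(U) − H₁(1)‖ ≤ C₂·ε`** for the
chain's `G₁(U) = B11Eq103H1Complex.G1LatticeK hpos` and `H₁(U) = H1LatticeK hpos hQ` (ANY positivity / surjectivity witnesses at `U` and at `1`, e.g.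
`B9Thm311SmallFieldClosed.laplaceAofBackground_pos_of_small_field`, `B5Eq172FlatCoercivity.laplaceAofBackground_one_pos`,
`B9Eq315QTorusOnto.QtorusW_surjective`), at EVERY background of E162's data with `‖U(b) − 1‖ ≤ ε ≤ ε₇` and `hRS`.  Inputs: §2 (`δ_Δ = C_Δ·ε`), NE9
leaf-04's `δ_Q`, the uniform coercivity `γ₁` (`B9Thm311SmallFieldGreen`) and operator bound (`B9Eq3126H1Bound.norm_laplaceAofBackground_le`) of
`Δ_a`, the flat modulus of `Q(1)†` halved, and the resolvent letters `B9Eq386ResolventLetters.norm_G1K_sub_le` / `norm_H1K_sub_le`.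
[cite: Balaban1985BackgroundPropagators, Thm 3.4 p.400, (3.86) p.407, (3.126) p.420, Thm 3.11 p.416; Balaban1985Variational, (45) p.285] -/
theorem exists_lipschitz_G1_H1_at_flat {η : ℝ} (hη : η ≠ 0) {a : ℝ} (ha : 0 < a) {Mφ Mφ' : ℝ} (hMφ : 0 ≤ Mφ) (hMφ' : 0 ≤ Mφ')
    (hφ : ∀ w, ‖φ w‖ ≤ Mφ * ‖w‖) (hφ' : ∀ X, ‖φ.symm X‖ ≤ Mφ' * ‖X‖) (τ : 𝔸 →ₗ[ℂ] ℂ) {Cτ : ℝ} (hτ : ∀ X, ‖τ X‖ ≤ Cτ * ‖X‖) (hCτ : 0 ≤ Cτ) :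
    ∃ C₁ C₂ ε₇ : ℝ, 0 < C₁ ∧ 0 < C₂ ∧ 0 < ε₇ ∧ ∀ (U : Bond d (fineP L m) → 𝔸ˣ) {α : ℝ} (hα1 : α ≤ 1 / 64)
      (hU1 : ∀ (x : B7Prop1Explicit.Site d) (κ : Fin d), perCfg (fineP L m) U x κ ∈ U1 𝔸)
      (hreg : ∀ (y : TSite d m) (κ : Fin d) (r : Fin d → Fin L), ‖((Wcx L (perCfg (fineP L m) U) (cornerSite L y) κ (boxVec L r) : 𝔸ˣ) : 𝔸) - 1‖ ≤ α)
      {ε : ℝ}, 0 ≤ ε → ε ≤ ε₇ → (∀ b, ‖(U b : 𝔸) - 1‖ ≤ ε) →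
      (∀ (b : Bond d (fineP L m)) (v u : W), ⟪adTransportW φ U b v, u⟫_ℂ = ⟪v, adTransportW φ (fun b => (U b)⁻¹) b u⟫_ℂ) →
      ∀ (hpos : ∀ x : BondL2K ℂ d (fineP L m) c₀ W, x ≠ 0 →
          0 < RCLike.re ⟪x, laplaceAofBackground L m hL φ U hα1 hU1 hreg τ η (c₀ := c₀) (c₁ := c₁) a x⟫_ℂ)
        (hQ : Function.Surjective (QtorusW L m hL φ U hα1 hU1 hreg (c₀ := c₀) (c₁ := c₁)))
        (hpos₁ : ∀ x : BondL2K ℂ d (fineP L m) c₀ W, x ≠ 0 →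
          0 < RCLike.re ⟪x, laplaceAofBackground L m hL φ (fun _ => 1) (show (0 : ℝ) ≤ 1 / 64 by norm_num) (hU1_one L m) (hreg_one L m) τ η
            (c₀ := c₀) (c₁ := c₁) a x⟫_ℂ)
        (hQ₁ : Function.Surjective (QtorusW L m hL φ (fun _ => 1) (show (0 : ℝ) ≤ 1 / 64 by norm_num) (hU1_one L m) (hreg_one L m)
          (c₀ := c₀) (c₁ := c₁))),
      (∀ z : BondL2K ℂ d (fineP L m) c₀ W,
        ‖G1LatticeK (Δ₁ := hessOp φ η U τ) (Q := QtorusW L m hL φ U hα1 hU1 hreg (c₀ := c₀) (c₁ := c₁)) hpos z -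
          G1LatticeK (Δ₁ := hessOp φ η (fun _ => 1) τ)
            (Q := QtorusW L m hL φ (fun _ => 1) (show (0 : ℝ) ≤ 1 / 64 by norm_num) (hU1_one L m) (hreg_one L m) (c₀ := c₀) (c₁ := c₁)) hpos₁ z‖ ≤
        C₁ * ε * ‖z‖) ∧
      (∀ b : BondL2K ℂ d m c₁ W,
        ‖H1LatticeK (Δ₁ := hessOp φ η U τ) (Q := QtorusW L m hL φ U hα1 hU1 hreg (c₀ := c₀) (c₁ := c₁)) hpos hQ b -
          H1LatticeK (Δ₁ := hessOp φ η (fun _ => 1) τ)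
            (Q := QtorusW L m hL φ (fun _ => 1) (show (0 : ℝ) ≤ 1 / 64 by norm_num) (hU1_one L m) (hreg_one L m) (c₀ := c₀) (c₁ := c₁)) hpos₁ hQ₁ b‖ ≤
        C₂ * ε * ‖b‖) := by
  have hc₀ : 0 < c₀ := Fact.out
  have hc : conj ((η : ℂ))⁻¹ = ((η : ℂ))⁻¹ := by rw [map_inv₀, Complex.conj_ofReal]
  have hαL0 : 50 * (d + 1) * (0 : ℝ) * (L : ℝ) ^ d ≤ 1 / 2 := by norm_num
  -- the uniform coercivity of `Δ_a(U)` (also at `U = 1`)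
  obtain ⟨γ₁, ε₃, hγ₁, hε₃, Hc⟩ := exists_coercive_laplaceA_of_small_field L m hL φ (c₀ := c₀) (c₁ := c₁) hη ha hMφ hMφ' hφ hφ' τ hτ hCτ
  -- (3.84): `δ_Δ = C_Δ·ε`
  obtain ⟨CΔ, ε₆, hCΔ, hε₆, HΔ⟩ := exists_laplaceAofBackground_sub_flat_le L m hL φ (c₀ := c₀) (c₁ := c₁) hη a hMφ hMφ' hφ hφ' τ hτ hCτ
  -- the flat averaging: operator norm `MQ1` and the modulus `μQ1` of `Q(1)†`
  obtain ⟨MQ1, hMQ1def⟩ : ∃ MQ1 : ℝ, MQ1 = ‖LinearMap.toContinuousLinearMap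
    (QtorusW L m hL φ (fun _ => 1) (show (0 : ℝ) ≤ 1 / 64 by norm_num) (hU1_one L m) (hreg_one L m) (c₀ := c₀) (c₁ := c₁))‖ := ⟨_, rfl⟩
  have hMQ1 : 0 ≤ MQ1 := by
    rw [hMQ1def]
    exact norm_nonneg (LinearMap.toContinuousLinearMap
      (QtorusW L m hL φ (fun _ => 1) (show (0 : ℝ) ≤ 1 / 64 by norm_num) (hU1_one L m) (hreg_one L m) (c₀ := c₀) (c₁ := c₁)))
  have hQ1 : ∀ x : BondL2K ℂ d (fineP L m) c₀ W,
      ‖QtorusW L m hL φ (fun _ => 1) (show (0 : ℝ) ≤ 1 / 64 by norm_num) (hU1_one L m) (hreg_one L m) (c₀ := c₀) (c₁ := c₁) x‖ ≤ MQ1 * ‖x‖ :=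
    fun x => by
      rw [hMQ1def]
      exact (LinearMap.toContinuousLinearMap
        (QtorusW L m hL φ (fun _ => 1) (show (0 : ℝ) ≤ 1 / 64 by norm_num) (hU1_one L m) (hreg_one L m) (c₀ := c₀) (c₁ := c₁))).le_opNorm x
  obtain ⟨μQ1, hμQ1, hQ1adj⟩ := exists_modulus_of_injective
    (LinearMap.adjoint (QtorusW L m hL φ (fun _ => 1) (show (0 : ℝ) ≤ 1 / 64 by norm_num) (hU1_one L m) (hreg_one L m) (c₀ := c₀) (c₁ := c₁)))
    (adjoint_injective_of_surjective _ (QtorusW_surjective L m hL (fun _ => 1) (show (0 : ℝ) ≤ 1 / 64 by norm_num) (hU1_one L m) (hreg_one L m) hαL0 φ))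
  -- the constants
  obtain ⟨KR, hKRdef⟩ : ∃ KR : ℝ, KR = 2 * Mφ * Mφ' := ⟨_, rfl⟩
  have hKR : 0 ≤ KR := by rw [hKRdef]; positivity
  obtain ⟨CQ, hCQdef⟩ : ∃ CQ : ℝ, CQ = Mφ' * Mφ * Real.sqrt (c₁ * Fintype.card (Bond d m) / c₀) * (102 * (d + 1) ^ 2 * L) := ⟨_, rfl⟩
  have hCQ : 0 ≤ CQ := by rw [hCQdef]; positivity
  obtain ⟨MT, hMTdef⟩ : ∃ MT : ℝ, MT = 64 * d * ‖((η : ℂ))⁻¹‖ ^ 2 + 16 * ‖((η : ℂ))⁻¹‖ ^ 2 * d +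
      32 * d * Cτ * Mφ ^ 2 * (|η| ^ d / c₀) * (‖((η : ℂ))⁻¹‖ ^ 2 * (4 * 1)) + (MQ1 + CQ) * (|a| * (MQ1 + CQ)) + 1 := ⟨_, rfl⟩
  have hMT0 : 0 < MT := by rw [hMTdef]; positivity
  obtain ⟨κ, hκdef⟩ : ∃ κ : ℝ, κ = γ₁ * (μQ1 / 2) ^ 2 / MT ^ 2 := ⟨_, rfl⟩
  have hκ : 0 < κ := by rw [hκdef]; positivity
  refine ⟨γ₁⁻¹ * CΔ * γ₁⁻¹,
    γ₁⁻¹ * CΔ * γ₁⁻¹ * ((MQ1 + CQ) * κ⁻¹) + γ₁⁻¹ * (CQ * κ⁻¹) +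
      γ₁⁻¹ * ((MQ1 + CQ) * (κ⁻¹ * (CQ * (γ₁⁻¹ * (MQ1 + CQ)) + (MQ1 + CQ) * (γ₁⁻¹ * CΔ * γ₁⁻¹ * (MQ1 + CQ)) + (MQ1 + CQ) * (γ₁⁻¹ * CQ)) * κ⁻¹)) + 1,
    min ε₃ (min (1 / (KR + 1)) (min 1 (min (μQ1 / (2 * CQ + 1)) ε₆))), by positivity, by positivity, by positivity, ?_⟩
  intro U α hα1 hU1 hreg ε hε hε₇ hUε hRS hpos hQs hpos₁ hQs₁
  have hεε₃ : ε ≤ ε₃ := hε₇.trans (min_le_left _ _)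
  have hε1' : ε ≤ 1 / (KR + 1) := hε₇.trans ((min_le_right _ _).trans (min_le_left _ _))
  have hε1 : ε ≤ 1 := hε₇.trans ((min_le_right _ _).trans ((min_le_right _ _).trans (min_le_left _ _)))
  have hεμ : ε ≤ μQ1 / (2 * CQ + 1) := hε₇.trans ((min_le_right _ _).trans ((min_le_right _ _).trans ((min_le_right _ _).trans (min_le_left _ _))))
  have hεε₆ : ε ≤ ε₆ := hε₇.trans ((min_le_right _ _).trans ((min_le_right _ _).trans ((min_le_right _ _).trans (min_le_right _ _))))
  have hεR1 : 2 * Mφ * Mφ' * ε ≤ 1 := by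
    rw [← hKRdef]
    refine (mul_le_mul_of_nonneg_left hε1' hKR).trans ?_
    rw [mul_one_div, div_le_one (by positivity)]; linarith
  have hεR1₀ : 2 * Mφ * Mφ' * (0 : ℝ) ≤ 1 := by norm_num
  have hδQ : CQ * ε ≤ μQ1 / 2 := by
    have h1 : CQ * ε ≤ CQ * (μQ1 / (2 * CQ + 1)) := mul_le_mul_of_nonneg_left hεμ hCQ
    have h2 : CQ * (μQ1 / (2 * CQ + 1)) ≤ μQ1 / 2 := by
      rw [mul_div_assoc', div_le_div_iff₀ (by positivity) (by norm_num)]; nlinarith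
    exact h1.trans h2
  -- flat data: `‖1 − 1‖ ≤ 0`, `hRS` at `1`
  have hU0 : ∀ b : Bond d (fineP L m), ‖(((fun _ => (1 : 𝔸ˣ)) b : 𝔸ˣ) : 𝔸) - 1‖ ≤ (0 : ℝ) := fun b => by simp
  have hRS₁ := hRS_one L m φ (𝔸 := 𝔸)
  -- `Q(U)`, `Q(1)`: operator bounds, difference, moduli of the adjoints
  have hQdiff : ∀ x : BondL2K ℂ d (fineP L m) c₀ W, ‖QtorusW L m hL φ U hα1 hU1 hreg (c₁ := c₁) x -
      QtorusW L m hL φ (fun _ => 1) (show (0 : ℝ) ≤ 1 / 64 by norm_num) (hU1_one L m) (hreg_one L m) (c₁ := c₁) x‖ ≤ CQ * ε * ‖x‖ := fun x => by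
    refine (norm_QtorusW_sub_flat_le L m hL U hα1 hU1 hreg (show (0 : ℝ) ≤ 1 / 64 by norm_num) (hU1_one L m) (hreg_one L m) hε hUε φ
      hMφ hφ hMφ' hφ' x).trans (le_of_eq ?_)
    rw [hCQdef]; ring
  have hQdiff' : ∀ x : BondL2K ℂ d (fineP L m) c₀ W,
      ‖QtorusW L m hL φ (fun _ => 1) (show (0 : ℝ) ≤ 1 / 64 by norm_num) (hU1_one L m) (hreg_one L m) (c₁ := c₁) x -
        QtorusW L m hL φ U hα1 hU1 hreg (c₁ := c₁) x‖ ≤ CQ * ε * ‖x‖ := fun x => by rw [norm_sub_rev]; exact hQdiff x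
  have hQU : ∀ x : BondL2K ℂ d (fineP L m) c₀ W, ‖QtorusW L m hL φ U hα1 hU1 hreg (c₀ := c₀) (c₁ := c₁) x‖ ≤ (MQ1 + CQ) * ‖x‖ := fun x => by
    have h1 := hQ1 x
    have h2 := hQdiff x
    have h3 := norm_le_insert' (QtorusW L m hL φ U hα1 hU1 hreg (c₀ := c₀) (c₁ := c₁) x)
      (QtorusW L m hL φ (fun _ => 1) (show (0 : ℝ) ≤ 1 / 64 by norm_num) (hU1_one L m) (hreg_one L m) (c₀ := c₀) (c₁ := c₁) x)
    have h4 : CQ * ε * ‖x‖ ≤ CQ * ‖x‖ := mul_le_mul_of_nonneg_right (mul_le_of_le_one_right hCQ hε1) (norm_nonneg x)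
    linarith
  have hQ1' : ∀ x : BondL2K ℂ d (fineP L m) c₀ W,
      ‖QtorusW L m hL φ (fun _ => 1) (show (0 : ℝ) ≤ 1 / 64 by norm_num) (hU1_one L m) (hreg_one L m) (c₀ := c₀) (c₁ := c₁) x‖ ≤ (MQ1 + CQ) * ‖x‖ :=
    fun x => (hQ1 x).trans (mul_le_mul_of_nonneg_right (le_add_of_nonneg_right hCQ) (norm_nonneg x))
  have hQUadj : ∀ y : BondL2K ℂ d m c₁ W, μQ1 / 2 * ‖y‖ ≤ ‖LinearMap.adjoint (QtorusW L m hL φ U hα1 hU1 hreg (c₀ := c₀) (c₁ := c₁)) y‖ := fun y => by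
    have h1 := hQ1adj y
    have h2 : ‖LinearMap.adjoint (QtorusW L m hL φ U hα1 hU1 hreg (c₀ := c₀) (c₁ := c₁) -
        QtorusW L m hL φ (fun _ => 1) (show (0 : ℝ) ≤ 1 / 64 by norm_num) (hU1_one L m) (hreg_one L m) (c₀ := c₀) (c₁ := c₁)) y‖ ≤ CQ * ε * ‖y‖ :=
      norm_adjoint_apply_le _ (by positivity) (fun x => by rw [LinearMap.sub_apply]; exact hQdiff x) y
    rw [map_sub, LinearMap.sub_apply] at h2
    have h3 := norm_le_insert (LinearMap.adjoint (QtorusW L m hL φ U hα1 hU1 hreg (c₀ := c₀) (c₁ := c₁)) y)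
      (LinearMap.adjoint (QtorusW L m hL φ (fun _ => 1) (show (0 : ℝ) ≤ 1 / 64 by norm_num) (hU1_one L m) (hreg_one L m) (c₀ := c₀) (c₁ := c₁)) y)
    have h4 : CQ * ε * ‖y‖ ≤ μQ1 / 2 * ‖y‖ := mul_le_mul_of_nonneg_right hδQ (norm_nonneg _)
    linarith
  have hQ1adj' : ∀ y : BondL2K ℂ d m c₁ W, μQ1 / 2 * ‖y‖ ≤
      ‖LinearMap.adjoint (QtorusW L m hL φ (fun _ => 1) (show (0 : ℝ) ≤ 1 / 64 by norm_num) (hU1_one L m) (hreg_one L m) (c₀ := c₀) (c₁ := c₁)) y‖ :=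
    fun y => (hQ1adj y).trans' (by nlinarith [norm_nonneg y, hμQ1])
  -- the operator bound `MT` and the coercivity `γ₁` of `Δ_a`, at `U` and at `1`, in the `laplaceAK` form
  have hMTU := norm_laplaceAofBackground_le L m hL φ hMφ hMφ' hφ hφ' τ hτ hCτ (η := η) a U hα1 hU1 hreg hε hεR1 hUε hRS (by positivity) hQU
  have hMT1 := norm_laplaceAofBackground_le L m hL φ hMφ hMφ' hφ hφ' τ hτ hCτ (η := η) a (fun _ => 1) (show (0 : ℝ) ≤ 1 / 64 by norm_num)
    (hU1_one L m) (hreg_one L m) le_rfl hεR1₀ hU0 hRS₁ (by positivity) hQ1'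
  have hMT : ∀ x : BondL2K ℂ d (fineP L m) c₀ W,
      ‖laplaceAK (hessOp φ η U τ) (covDerivL2K ℂ c₀ ((η : ℂ))⁻¹ (adTransportW φ U)) (RofU L m φ η U)
        (covDivL2K ℂ c₀ ((η : ℂ))⁻¹ (adTransportW φ fun b => (U b)⁻¹)) (QtorusW L m hL φ U hα1 hU1 hreg (c₀ := c₀) (c₁ := c₁))
        (LinearMap.adjoint (QtorusW L m hL φ U hα1 hU1 hreg (c₀ := c₀) (c₁ := c₁))) (RCLike.ofReal a) x‖ ≤ MT * ‖x‖ := fun x => by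
    refine (hMTU x).trans (mul_le_mul_of_nonneg_right ?_ (norm_nonneg _))
    rw [hMTdef]
    have h1 : 32 * d * Cτ * Mφ ^ 2 * (|η| ^ d / c₀) * (‖((η : ℂ))⁻¹‖ ^ 2 * (4 * ε)) ≤
        32 * d * Cτ * Mφ ^ 2 * (|η| ^ d / c₀) * (‖((η : ℂ))⁻¹‖ ^ 2 * (4 * 1)) := by gcongr
    linarith
  have hMT' : ∀ x : BondL2K ℂ d (fineP L m) c₀ W,
      ‖laplaceAK (hessOp φ η (fun _ => 1) τ) (covDerivL2K ℂ c₀ ((η : ℂ))⁻¹ (adTransportW φ fun _ => 1)) (RofU L m φ η fun _ => 1)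
        (covDivL2K ℂ c₀ ((η : ℂ))⁻¹ (adTransportW φ fun b => ((fun _ => (1 : 𝔸ˣ)) b)⁻¹))
        (QtorusW L m hL φ (fun _ => 1) (show (0 : ℝ) ≤ 1 / 64 by norm_num) (hU1_one L m) (hreg_one L m) (c₀ := c₀) (c₁ := c₁))
        (LinearMap.adjoint (QtorusW L m hL φ (fun _ => 1) (show (0 : ℝ) ≤ 1 / 64 by norm_num) (hU1_one L m) (hreg_one L m) (c₀ := c₀) (c₁ := c₁)))
        (RCLike.ofReal a) x‖ ≤ MT * ‖x‖ := fun x => by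
    refine (hMT1 x).trans (mul_le_mul_of_nonneg_right ?_ (norm_nonneg _))
    rw [hMTdef]
    have h1 : 32 * d * Cτ * Mφ ^ 2 * (|η| ^ d / c₀) * (‖((η : ℂ))⁻¹‖ ^ 2 * (4 * (0 : ℝ))) ≤
        32 * d * Cτ * Mφ ^ 2 * (|η| ^ d / c₀) * (‖((η : ℂ))⁻¹‖ ^ 2 * (4 * 1)) := by gcongr; norm_num
    linarith
  have hcoer : ∀ x : BondL2K ℂ d (fineP L m) c₀ W, γ₁ * ‖x‖ ^ 2 ≤ RCLike.re ⟪x,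
      laplaceAK (hessOp φ η U τ) (covDerivL2K ℂ c₀ ((η : ℂ))⁻¹ (adTransportW φ U)) (RofU L m φ η U)
        (covDivL2K ℂ c₀ ((η : ℂ))⁻¹ (adTransportW φ fun b => (U b)⁻¹)) (QtorusW L m hL φ U hα1 hU1 hreg (c₀ := c₀) (c₁ := c₁))
        (LinearMap.adjoint (QtorusW L m hL φ U hα1 hU1 hreg (c₀ := c₀) (c₁ := c₁))) (RCLike.ofReal a) x⟫_ℂ :=
    fun x => Hc U hα1 hU1 hreg hε hεε₃ hUε hRS x
  have hcoer' : ∀ x : BondL2K ℂ d (fineP L m) c₀ W, γ₁ * ‖x‖ ^ 2 ≤ RCLike.re ⟪x,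
      laplaceAK (hessOp φ η (fun _ => 1) τ) (covDerivL2K ℂ c₀ ((η : ℂ))⁻¹ (adTransportW φ fun _ => 1)) (RofU L m φ η fun _ => 1)
        (covDivL2K ℂ c₀ ((η : ℂ))⁻¹ (adTransportW φ fun b => ((fun _ => (1 : 𝔸ˣ)) b)⁻¹))
        (QtorusW L m hL φ (fun _ => 1) (show (0 : ℝ) ≤ 1 / 64 by norm_num) (hU1_one L m) (hreg_one L m) (c₀ := c₀) (c₁ := c₁))
        (LinearMap.adjoint (QtorusW L m hL φ (fun _ => 1) (show (0 : ℝ) ≤ 1 / 64 by norm_num) (hU1_one L m) (hreg_one L m) (c₀ := c₀) (c₁ := c₁)))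
        (RCLike.ofReal a) x⟫_ℂ :=
    fun x => Hc (fun _ => 1) (show (0 : ℝ) ≤ 1 / 64 by norm_num) (hU1_one L m) (hreg_one L m) le_rfl hε₃.le hU0 hRS₁ x
  have hpos' : ∀ x : BondL2K ℂ d (fineP L m) c₀ W, x ≠ 0 → 0 < RCLike.re ⟪x,
      laplaceAK (hessOp φ η U τ) (covDerivL2K ℂ c₀ ((η : ℂ))⁻¹ (adTransportW φ U)) (RofU L m φ η U)
        (covDivL2K ℂ c₀ ((η : ℂ))⁻¹ (adTransportW φ fun b => (U b)⁻¹)) (QtorusW L m hL φ U hα1 hU1 hreg (c₀ := c₀) (c₁ := c₁))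
        (LinearMap.adjoint (QtorusW L m hL φ U hα1 hU1 hreg (c₀ := c₀) (c₁ := c₁))) (RCLike.ofReal a) x⟫_ℂ := hpos
  have hpos₁' : ∀ x : BondL2K ℂ d (fineP L m) c₀ W, x ≠ 0 → 0 < RCLike.re ⟪x,
      laplaceAK (hessOp φ η (fun _ => 1) τ) (covDerivL2K ℂ c₀ ((η : ℂ))⁻¹ (adTransportW φ fun _ => 1)) (RofU L m φ η fun _ => 1)
        (covDivL2K ℂ c₀ ((η : ℂ))⁻¹ (adTransportW φ fun b => ((fun _ => (1 : 𝔸ˣ)) b)⁻¹))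
        (QtorusW L m hL φ (fun _ => 1) (show (0 : ℝ) ≤ 1 / 64 by norm_num) (hU1_one L m) (hreg_one L m) (c₀ := c₀) (c₁ := c₁))
        (LinearMap.adjoint (QtorusW L m hL φ (fun _ => 1) (show (0 : ℝ) ≤ 1 / 64 by norm_num) (hU1_one L m) (hreg_one L m) (c₀ := c₀) (c₁ := c₁)))
        (RCLike.ofReal a) x⟫_ℂ := hpos₁
  -- `δ_Δ`: the data difference in the `laplaceAK` form (flat minus `U`)
  have hδT : ∀ x : BondL2K ℂ d (fineP L m) c₀ W,
      ‖laplaceAK (hessOp φ η (fun _ => 1) τ) (covDerivL2K ℂ c₀ ((η : ℂ))⁻¹ (adTransportW φ fun _ => 1)) (RofU L m φ η fun _ => 1)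
          (covDivL2K ℂ c₀ ((η : ℂ))⁻¹ (adTransportW φ fun b => ((fun _ => (1 : 𝔸ˣ)) b)⁻¹))
          (QtorusW L m hL φ (fun _ => 1) (show (0 : ℝ) ≤ 1 / 64 by norm_num) (hU1_one L m) (hreg_one L m) (c₀ := c₀) (c₁ := c₁))
          (LinearMap.adjoint (QtorusW L m hL φ (fun _ => 1) (show (0 : ℝ) ≤ 1 / 64 by norm_num) (hU1_one L m) (hreg_one L m) (c₀ := c₀) (c₁ := c₁)))
          (RCLike.ofReal a) x -
        laplaceAK (hessOp φ η U τ) (covDerivL2K ℂ c₀ ((η : ℂ))⁻¹ (adTransportW φ U)) (RofU L m φ η U)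
          (covDivL2K ℂ c₀ ((η : ℂ))⁻¹ (adTransportW φ fun b => (U b)⁻¹)) (QtorusW L m hL φ U hα1 hU1 hreg (c₀ := c₀) (c₁ := c₁))
          (LinearMap.adjoint (QtorusW L m hL φ U hα1 hU1 hreg (c₀ := c₀) (c₁ := c₁))) (RCLike.ofReal a) x‖ ≤ CΔ * ε * ‖x‖ := fun x => by
    rw [norm_sub_rev]; exact HΔ U hα1 hU1 hreg hε hεε₆ hUε hRS x
  have hμ2 : 0 < μQ1 / 2 := by positivity
  refine ⟨fun z => ?_, fun b => ?_⟩
  · have h := norm_G1K_sub_le (𝕜 := ℂ) (E := BondL2K ℂ d (fineP L m) c₀ W) (F := BondL2K ℂ d m c₁ W) (S := SiteL2K ℂ d (fineP L m) c₀ W)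
      (Δ₁ := hessOp φ η U τ (c₀ := c₀)) (Δ₂ := hessOp φ η (fun _ => 1) τ (c₀ := c₀))
      (D₁ := covDerivL2K ℂ c₀ ((η : ℂ))⁻¹ (adTransportW φ U)) (D₂ := covDerivL2K ℂ c₀ ((η : ℂ))⁻¹ (adTransportW φ fun _ => 1))
      (R₁ := RofU L m φ η U (c₀ := c₀)) (R₂ := RofU L m φ η (fun _ => 1) (c₀ := c₀))
      (Ds₁ := covDivL2K ℂ c₀ ((η : ℂ))⁻¹ (adTransportW φ fun b => (U b)⁻¹))
      (Ds₂ := covDivL2K ℂ c₀ ((η : ℂ))⁻¹ (adTransportW φ fun b => ((fun _ => (1 : 𝔸ˣ)) b)⁻¹))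
      (Q₁ := QtorusW L m hL φ U hα1 hU1 hreg (c₀ := c₀) (c₁ := c₁))
      (Q₂ := QtorusW L m hL φ (fun _ => 1) (show (0 : ℝ) ≤ 1 / 64 by norm_num) (hU1_one L m) (hreg_one L m) (c₀ := c₀) (c₁ := c₁))
      (a := RCLike.ofReal a) (γ := γ₁) (δT := CΔ * ε) hγ₁ hcoer hcoer' hpos' hpos₁' (by positivity) hδT z
    have h' : ‖G1LatticeK (Δ₁ := hessOp φ η U τ) (Q := QtorusW L m hL φ U hα1 hU1 hreg (c₀ := c₀) (c₁ := c₁)) hpos z -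
        G1LatticeK (Δ₁ := hessOp φ η (fun _ => 1) τ)
          (Q := QtorusW L m hL φ (fun _ => 1) (show (0 : ℝ) ≤ 1 / 64 by norm_num) (hU1_one L m) (hreg_one L m) (c₀ := c₀) (c₁ := c₁)) hpos₁ z‖ ≤
        γ₁⁻¹ * (CΔ * ε) * γ₁⁻¹ * ‖z‖ := h
    exact h'.trans (le_of_eq (by ring))
  · have h := norm_H1K_sub_le (𝕜 := ℂ) (E := BondL2K ℂ d (fineP L m) c₀ W) (F := BondL2K ℂ d m c₁ W) (S := SiteL2K ℂ d (fineP L m) c₀ W)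
      (Δ₁ := hessOp φ η U τ (c₀ := c₀)) (Δ₂ := hessOp φ η (fun _ => 1) τ (c₀ := c₀))
      (D₁ := covDerivL2K ℂ c₀ ((η : ℂ))⁻¹ (adTransportW φ U)) (D₂ := covDerivL2K ℂ c₀ ((η : ℂ))⁻¹ (adTransportW φ fun _ => 1))
      (R₁ := RofU L m φ η U (c₀ := c₀)) (R₂ := RofU L m φ η (fun _ => 1) (c₀ := c₀))
      (Ds₁ := covDivL2K ℂ c₀ ((η : ℂ))⁻¹ (adTransportW φ fun b => (U b)⁻¹))
      (Ds₂ := covDivL2K ℂ c₀ ((η : ℂ))⁻¹ (adTransportW φ fun b => ((fun _ => (1 : 𝔸ˣ)) b)⁻¹))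
      (Q₁ := QtorusW L m hL φ U hα1 hU1 hreg (c₀ := c₀) (c₁ := c₁))
      (Q₂ := QtorusW L m hL φ (fun _ => 1) (show (0 : ℝ) ≤ 1 / 64 by norm_num) (hU1_one L m) (hreg_one L m) (c₀ := c₀) (c₁ := c₁))
      (a := RCLike.ofReal a) (γ := γ₁) (MT := MT) (δT := CΔ * ε) hγ₁ hcoer hcoer' hMT hMT' hpos' hpos₁' (by positivity) hδT
      (MQ := MQ1 + CQ) (μQ := μQ1 / 2) (δQ := CQ * ε) (by positivity) hμ2 (by positivity) hQU hQ1' hQUadj hQ1adj' hQdiff'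
      (fun x' y' => (LinearMap.adjoint_inner_right _ x' y').symm) (adjoint_injective_of_modulus hμ2 hQUadj)
      (fun x' y' => (LinearMap.adjoint_inner_right _ x' y').symm) (adjoint_injective_of_modulus hμ2 hQ1adj') hMT0 b
    have h' : ‖H1LatticeK (Δ₁ := hessOp φ η U τ) (Q := QtorusW L m hL φ U hα1 hU1 hreg (c₀ := c₀) (c₁ := c₁)) hpos hQs b -
        H1LatticeK (Δ₁ := hessOp φ η (fun _ => 1) τ)
          (Q := QtorusW L m hL φ (fun _ => 1) (show (0 : ℝ) ≤ 1 / 64 by norm_num) (hU1_one L m) (hreg_one L m) (c₀ := c₀) (c₁ := c₁)) hpos₁ hQs₁ b‖ ≤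
        (γ₁⁻¹ * (CΔ * ε) * γ₁⁻¹ * ((MQ1 + CQ) * (γ₁ * (μQ1 / 2) ^ 2 / MT ^ 2)⁻¹) + γ₁⁻¹ * (CQ * ε * (γ₁ * (μQ1 / 2) ^ 2 / MT ^ 2)⁻¹) +
          γ₁⁻¹ * ((MQ1 + CQ) * ((γ₁ * (μQ1 / 2) ^ 2 / MT ^ 2)⁻¹ * (CQ * ε * (γ₁⁻¹ * (MQ1 + CQ)) +
            (MQ1 + CQ) * (γ₁⁻¹ * (CΔ * ε) * γ₁⁻¹ * (MQ1 + CQ)) + (MQ1 + CQ) * (γ₁⁻¹ * (CQ * ε))) * (γ₁ * (μQ1 / 2) ^ 2 / MT ^ 2)⁻¹))) * ‖b‖ := h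
    rw [← hκdef] at h'
    refine h'.trans ?_
    have hslack : 0 ≤ ε * ‖b‖ := mul_nonneg hε (norm_nonneg b)
    have hring : (γ₁⁻¹ * (CΔ * ε) * γ₁⁻¹ * ((MQ1 + CQ) * κ⁻¹) + γ₁⁻¹ * (CQ * ε * κ⁻¹) +
          γ₁⁻¹ * ((MQ1 + CQ) * (κ⁻¹ * (CQ * ε * (γ₁⁻¹ * (MQ1 + CQ)) +
            (MQ1 + CQ) * (γ₁⁻¹ * (CΔ * ε) * γ₁⁻¹ * (MQ1 + CQ)) + (MQ1 + CQ) * (γ₁⁻¹ * (CQ * ε))) * κ⁻¹))) * ‖b‖ + ε * ‖b‖ =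
        (γ₁⁻¹ * CΔ * γ₁⁻¹ * ((MQ1 + CQ) * κ⁻¹) + γ₁⁻¹ * (CQ * κ⁻¹) +
          γ₁⁻¹ * ((MQ1 + CQ) * (κ⁻¹ * (CQ * (γ₁⁻¹ * (MQ1 + CQ)) + (MQ1 + CQ) * (γ₁⁻¹ * CΔ * γ₁⁻¹ * (MQ1 + CQ)) + (MQ1 + CQ) * (γ₁⁻¹ * CQ)) * κ⁻¹)) + 1) *
          ε * ‖b‖ := by ring
    exact (le_add_of_nonneg_right hslack).trans hring.le

end Assembled

end Literature.MathematicalPhysics.QuantumFieldTheory.Balaban1983to89.B9Eq386LipschitzH1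

end
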